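import Summits.NavierStokesRegularity.FunctionalMining.TopEigLaminateTwo
import Summits.NavierStokesRegularity.FunctionalMining.TopEigHeatRate
import Literature.Analysis.FluidPDE.SignedPowers
import HarnessLib

/-!
# FunctionalMining / NoGo — K33a: the `q`-th strain-eigenvalue moments along a laminate's heat line,
# Bernoulli in tangent form, and the Wallis moments `I(a) = ∫₀¹|sin 2πs|^a` with a REAL exponent

HONEST FRAMING. Search for candidate a priori estimates; no regularity claim. Nothing about
Navier–Stokes is proved or asserted in this file; it is the profile-independent half of the no-go seat's
LAMINATE CEILING on Lemma L-λ's constant (K33b, `NoGo/TopEigHeatLaminateCeiling.lean`: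
`C_λ(q) ≤ 36π²q(q − 1)/(3q − 1)` for every real `q > 1`). Cell `pub-nsfunc`, no-go seat (gen 45). [ours]

CONTENT (all elementary; `u_F = (F(x₂), 0, 0)` is the tree's laminate `TopEigLaminate.lamU F`):
* §1 `topEigMoment_line_rpow`, `topEigMoment_line_half` — for EVERY profile `F`, every real `q > 0`, every real `t`:
  `∫(λ₁⁺)^q(u_F + tΔu_F) = ∫((−λ₃)⁺)^q(u_F + tΔu_F) = ∫₀¹|F′/2 + tF‴/2|^q = 2^{−q}∫₀¹|F′ + tF‴|^q`
  (plane shear: the strain of `u_F + tΔu_F = u_{F + tF″}` has eigenvalues `±½|F′ + tF‴|, 0`, tree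
  `lam_sq_line`; then Lemma D `integral_comp_dirForm`). The `q = 1` case is K32's `topEigMoment_one_line`.
* §2 `heatDissipation_le_of_line` — if `Φ(v) − Φ(v + tΔv) ≤ t·(R·Φ(v))` for all `t > 0` then
  `heatDissipation Φ v ≤ R·Φ(v)` (`ciSup_le`; the static dissipation of `TopEigHeatCoercive.lean`).
* §3 `tangent_le_abs_rpow` — Bernoulli's inequality with a real exponent in TANGENT form through `|·|`:
  `a^q + q·a^{q−1}·(P − a) ≤ |P|^q` for `a ≥ 0`, `q ≥ 1`, EVERY real `P` (Mathlib's
  `one_add_mul_self_le_rpow_one_add` for `P ≥ 0`; for `P < 0` the left side is `≤ 0`); `|x|^p(x²)^r = |x|^{p+2r}`.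
* §4 `sinAbsMoment a = I(a) := ∫₀¹|sin 2πs|^a ds` (real `a ≥ 0`): `sinAbsMoment_pos : 0 < I(a)` and the Wallis
  recursion with a REAL exponent **`sinAbsMoment_rec : (r + 2)·I(r + 2) = (r + 1)·I(r)`** (`r > 1`; integration
  by parts with `u = |S|^r S`, `v = −cos(2πs)/(2π)`, `S = sin 2πs`, `u′ = 2π(r + 1)|S|^r cos 2πs` by
  `hasDerivAt_norm_rpow`; boundary terms vanish at `S(0) = S(1) = 0`); `sinAbsMoment_rec_three :
  3q·I(3q) = (3q − 1)·I(3q − 2)` (`q > 1`), the form K33b consumes.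

SCOPE, EXACTLY: identities and inequalities of real analysis plus the line formula; no statement about
`C_λ(q)` is made here (that is K33b). PROVENANCE / STATUS. Typed by the no-go seat (gen 45); farm-checked
STAND-ALONE under its TREE imports (`lean check` rc 0, 0 sorries, 0 warnings; axioms standard). STATUS: STAGED.
FILING (prove seat g27, REQUEST #49): declarations byte-identical to the no-go seat's staged `TopEigLaminateHeatLine.STAGING.lean` 666e717dacac6e64; this line is the only addition (staged v3 = v1 with the dedup-forced rename topEigMoment_line → topEigMoment_line_rpow and the dedup-forced deletion of the local abs_rpow_mul_sq in favour of the tree Literature.Analysis.FluidPDE.LeiZhang2011.abs_rpow_mul_sq, after gate bounces p371916 name-exists and p371942 dedup.landed).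
-/

noncomputable section

open MeasureTheory Set intervalIntegral Real
open scoped ContDiff Topology

namespace Summit.NavierStokesRegularity.FunctionalMining

open Literature.Analysis Literature.Analysis.FunctionSpaces Literature.Analysis.FunctionSpaces.Torus
open TopEig PlanarTopEig StrainL4 LaminateDirection
-- the landed [folklore] `LeiZhang2011.abs_rpow_mul_sq` (`Literature/Analysis/FluidPDE/SignedPowers.lean`),
-- reused instead of a local copy per the gateʼs `dedup.landed` rule (p371942)
open Literature.Analysis.FluidPDE.LeiZhang2011 (abs_rpow_mul_sq)

namespace TopEigLaminate

variable (F : ShearProfile)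

/-! ## 1. The `q`-th moments along the heat line of a general laminate -/

/-- Lemma D, `|·|^q` form: `∫_{T³} |P(x₂)/2 + t·Q(x₂)/2|^q dx = ∫₀¹ |P/2 + t·Q/2|^q` (`q ≥ 0`). [ours] -/
theorem integral_line_abs_rpow (P Q : ShearProfile) (t : ℝ) {q : ℝ} (hq : 0 ≤ q) :
    ∫ x, |dirFun e2 P x / 2 + t * (dirFun e2 Q x / 2)| ^ q =
      ∫ s in (0 : ℝ)..1, |P s / 2 + t * (Q s / 2)| ^ q := by
  have hc : Continuous fun y : UnitAddCircle => |P.onCircle y / 2 + t * (Q.onCircle y / 2)| ^ q :=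
    ((P.continuous_onCircle.div_const _).add
      (continuous_const.mul (Q.continuous_onCircle.div_const _))).abs.rpow_const fun _ => Or.inr hq
  have h := integral_comp_dirForm e2_ne_zero (F := fun y => |P.onCircle y / 2 + t * (Q.onCircle y / 2)| ^ q)
    hc.aestronglyMeasurable
  simp only [dirFun] at h ⊢
  rw [h, CellularStretching.integral_circle_eq_intervalIntegral]
  simp only [ShearProfile.onCircle_coe]

/-- **The two `q`-th moments along the heat line of `u_F`** (`q > 0`):
`∫(λ₁⁺)^q(u_F + tΔu_F) = ∫((−λ₃)⁺)^q(u_F + tΔu_F) = ∫₀¹ |F′/2 + t·F‴/2|^q`. [ours] -/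
theorem topEigMoment_line_rpow (t : ℝ) {q : ℝ} (hq : 0 < q) :
    torusTopEigMoment q (lamU F + t • Torus.laplacian (lamU F)) =
        ∫ s in (0 : ℝ)..1, |F.D s / 2 + t * (F.D.D.D s / 2)| ^ q ∧
      torusNegBotEigMoment q (lamU F + t • Torus.laplacian (lamU F)) =
        ∫ s in (0 : ℝ)..1, |F.D s / 2 + t * (F.D.D.D s / 2)| ^ q := by
  rw [← integral_line_abs_rpow _ _ _ hq.le]
  constructor
  · unfold torusTopEigMoment
    refine integral_congr_ae (ae_of_all _ fun x => ?_)
    obtain ⟨h1, -, h3, -⟩ := lam_sq_line F t x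
    dsimp only
    rw [← lam_strainFlat, max_eq_left h3, (sq_eq_sq₀ h3 (abs_nonneg _)).1 (h1.trans (sq_abs _).symm)]
  · unfold torusNegBotEigMoment
    refine integral_congr_ae (ae_of_all _ fun x => ?_)
    obtain ⟨-, h1, -, h4⟩ := lam_sq_line F t x
    dsimp only
    rw [← lam_neg_strainFlat, max_eq_left h4, (sq_eq_sq₀ h4 (abs_nonneg _)).1 (h1.trans (sq_abs _).symm)]

/-- `∫₀¹ |P/2 + tQ/2|^q = 2^{−q} ∫₀¹ |P + tQ|^q`. [ours; bookkeeping] -/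
theorem integral_abs_rpow_half (P Q : ShearProfile) (t q : ℝ) :
    ∫ s in (0 : ℝ)..1, |P s / 2 + t * (Q s / 2)| ^ q =
      (1 / 2 : ℝ) ^ q * ∫ s in (0 : ℝ)..1, |P s + t * Q s| ^ q := by
  rw [← intervalIntegral.integral_const_mul]
  refine intervalIntegral.integral_congr fun s _ => ?_
  rw [show P s / 2 + t * (Q s / 2) = (1 / 2) * (P s + t * Q s) by ring, abs_mul,
    abs_of_pos (by norm_num : (0 : ℝ) < 1 / 2), Real.mul_rpow (by norm_num) (abs_nonneg _)]

/-- **Heat line of `u_F`, all `q > 0`: `∫(λ₁⁺)^q(u_F + tΔu_F) = ∫((−λ₃)⁺)^q(…) = 2^{−q}∫₀¹|F′ + tF‴|^q`.** [ours] -/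
theorem topEigMoment_line_half (t : ℝ) {q : ℝ} (hq : 0 < q) :
    torusTopEigMoment q (lamU F + t • Torus.laplacian (lamU F)) =
        (1 / 2 : ℝ) ^ q * ∫ s in (0 : ℝ)..1, |F.D s + t * F.D.D.D s| ^ q ∧
      torusNegBotEigMoment q (lamU F + t • Torus.laplacian (lamU F)) =
        (1 / 2 : ℝ) ^ q * ∫ s in (0 : ℝ)..1, |F.D s + t * F.D.D.D s| ^ q := by
  rw [← integral_abs_rpow_half]; exact topEigMoment_line_rpow F t hq

/-! ## 2. A heat line along which `Φ` drops at most at rate `R·Φ` has dissipation `≤ R·Φ` -/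

/-- **If `Φ(v) − Φ(v + tΔv) ≤ t·(R·Φ(v))` for every `t > 0` then `heatDissipation Φ v ≤ R·Φ(v)`.**
[ours, bookkeeping] -/
theorem heatDissipation_le_of_line {d : Type*} [Fintype d] [DecidableEq d]
    {Φ : (UnitAddTorus d → EuclideanSpace ℝ d) → ℝ} {v : UnitAddTorus d → EuclideanSpace ℝ d} {R : ℝ}
    (h : ∀ t : ℝ, 0 < t → Φ v - Φ (v + t • Torus.laplacian v) ≤ t * (R * Φ v)) :
    heatDissipation Φ v ≤ R * Φ v := by
  haveI : Nonempty {t : ℝ // 0 < t} := ⟨⟨1, one_pos⟩⟩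
  exact ciSup_le fun t => (div_le_iff₀ t.2).2 (by rw [mul_comm]; exact h t.1 t.2)

/-! ## 3. Bernoulli's inequality with a real exponent, tangent form through `|·|` -/

/-- **Tangent (Bernoulli) inequality for `x ↦ x^q` on `[0, ∞)`, real `q ≥ 1`, through `|·|`**:
`a^q + q·a^{q−1}·(P − a) ≤ |P|^q` for every `a ≥ 0` and every real `P`. [folklore; from Mathlib's
`one_add_mul_self_le_rpow_one_add`] -/
theorem tangent_le_abs_rpow {a P q : ℝ} (ha : 0 ≤ a) (hq : 1 ≤ q) :
    a ^ q + q * a ^ (q - 1) * (P - a) ≤ |P| ^ q := by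
  have hPq : 0 ≤ |P| ^ q := rpow_nonneg (abs_nonneg _) _
  rcases ha.eq_or_lt with rfl | ha'
  · rcases eq_or_ne q 1 with rfl | hq1
    · simpa using le_abs_self P
    · rw [zero_rpow (by linarith), zero_rpow (sub_ne_zero.2 hq1)]; simpa using hPq
  have hsplit : a ^ q = a ^ (q - 1) * a := by rw [rpow_sub_one ha'.ne']; field_simp
  have haq1 : 0 ≤ a ^ (q - 1) := rpow_nonneg ha _
  rcases le_or_gt 0 P with hP | hP
  · have hs : -1 ≤ P / a - 1 := by have := div_nonneg hP ha; linarith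
    have hb := one_add_mul_self_le_rpow_one_add hs hq
    rw [show 1 + (P / a - 1) = P / a by ring, div_rpow hP ha] at hb
    have haq : 0 < a ^ q := rpow_pos_of_pos ha' q
    have key : a ^ q * (1 + q * (P / a - 1)) ≤ P ^ q := by
      have h := mul_le_mul_of_nonneg_left hb haq.le
      rwa [mul_div_cancel₀ _ haq.ne'] at h
    have e : a ^ q * (1 + q * (P / a - 1)) = a ^ q + q * a ^ (q - 1) * (P - a) := by
      rw [hsplit]; field_simp
    rw [abs_of_nonneg hP, ← e]; exact key
  · have h1 : q * a ^ (q - 1) * (P - a) ≤ q * a ^ (q - 1) * (0 - a) :=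
      mul_le_mul_of_nonneg_left (by linarith) (mul_nonneg (by linarith) haq1)
    have h2 : a ^ (q - 1) * a * (1 - q) ≤ 0 :=
      mul_nonpos_of_nonneg_of_nonpos (mul_nonneg haq1 ha) (by linarith)
    nlinarith [h1, h2, hPq, hsplit]

/-- `|x|^p · (x²)^r = |x|^{p + 2r}` (`p + 2r ≠ 0`). [folklore; bookkeeping] -/
theorem abs_rpow_mul_sq_rpow (x : ℝ) {p r : ℝ} (h : p + 2 * r ≠ 0) :
    |x| ^ p * (x ^ 2) ^ r = |x| ^ (p + 2 * r) := by
  rw [← sq_abs, ← rpow_two, ← rpow_mul (abs_nonneg x), ← rpow_add' (abs_nonneg x) h]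

/-! ## 4. The moments `I(a) = ∫₀¹ |sin 2πs|^a ds` (real `a ≥ 0`): positivity and the Wallis recursion -/

/-- **`I(a) := ∫₀¹ |sin(2πs)|^a ds`** (real exponent). [ours, bookkeeping] -/
def sinAbsMoment (a : ℝ) : ℝ := ∫ s in (0 : ℝ)..1, |sin (2 * π * s)| ^ a

/-- `s ↦ sin 2πs` is continuous. [folklore] -/
theorem continuous_sin_two_pi_mul : Continuous fun s : ℝ => sin (2 * π * s) := by fun_prop

/-- `s ↦ |sin 2πs|^a` is continuous for `a ≥ 0`. [folklore] -/
theorem continuous_abs_sin_rpow {a : ℝ} (ha : 0 ≤ a) : Continuous fun s : ℝ => |sin (2 * π * s)| ^ a :=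
  continuous_sin_two_pi_mul.abs.rpow_const fun _ => Or.inr ha

/-- **`I(a) > 0`** for every real `a ≥ 0` (the integrand is positive on `(0, ½)`). [folklore] -/
theorem sinAbsMoment_pos {a : ℝ} (ha : 0 ≤ a) : 0 < sinAbsMoment a := by
  have hc := continuous_abs_sin_rpow ha
  unfold sinAbsMoment
  rw [← intervalIntegral.integral_add_adjacent_intervals (hc.intervalIntegrable 0 (1 / 2))
    (hc.intervalIntegrable (1 / 2) 1)]
  have h1 : 0 < ∫ s in (0 : ℝ)..(1 / 2), |sin (2 * π * s)| ^ a := by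
    refine intervalIntegral.intervalIntegral_pos_of_pos_on (hc.intervalIntegrable _ _) (fun s hs => ?_)
      (by norm_num)
    refine rpow_pos_of_pos (abs_pos.2 (sin_pos_of_pos_of_lt_pi ?_ ?_).ne') _
    · nlinarith [pi_pos, hs.1]
    · nlinarith [pi_pos, hs.2]
  have h2 : 0 ≤ ∫ s in (1 / 2 : ℝ)..1, |sin (2 * π * s)| ^ a :=
    intervalIntegral.integral_nonneg (by norm_num) fun s _ => rpow_nonneg (abs_nonneg _) _
  linarith

/-- **Wallis recursion with a real exponent: `(r + 2)·I(r + 2) = (r + 1)·I(r)`** for every real `r > 1`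
(integration by parts with `u = |S|^r·S`, `v = −cos(2πs)/(2π)`, `S = sin(2πs)`; the boundary terms vanish
because `S(0) = S(1) = 0`). [folklore; ours in this form] -/
theorem sinAbsMoment_rec {r : ℝ} (hr : 1 < r) :
    (r + 2) * sinAbsMoment (r + 2) = (r + 1) * sinAbsMoment r := by
  have hr0 : r ≠ 0 := by positivity
  have hS : ∀ s : ℝ, HasDerivAt (fun s : ℝ => sin (2 * π * s)) (cos (2 * π * s) * (2 * π)) s := fun s =>
    (hasDerivAt_sin (2 * π * s)).comp s (by simpa using (hasDerivAt_id s).const_mul (2 * π))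
  have hC : ∀ s : ℝ, HasDerivAt (fun s : ℝ => cos (2 * π * s)) (-sin (2 * π * s) * (2 * π)) s := fun s =>
    (hasDerivAt_cos (2 * π * s)).comp s (by simpa using (hasDerivAt_id s).const_mul (2 * π))
  have hu : ∀ s : ℝ, HasDerivAt (fun s => |sin (2 * π * s)| ^ r * sin (2 * π * s))
      ((r + 1) * |sin (2 * π * s)| ^ r * (cos (2 * π * s) * (2 * π))) s := by
    intro s
    have h1 : HasDerivAt (fun x : ℝ => ‖x‖ ^ r) (r * ‖sin (2 * π * s)‖ ^ (r - 2) * sin (2 * π * s))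
        (sin (2 * π * s)) := hasDerivAt_norm_rpow _ hr
    have h2 := (h1.comp s (hS s)).mul (hS s)
    simp only [Real.norm_eq_abs, Function.comp_def] at h2
    refine h2.congr_deriv ?_
    have e : |sin (2 * π * s)| ^ (r - 2) * sin (2 * π * s) ^ 2 = |sin (2 * π * s)| ^ r := by
      rw [abs_rpow_mul_sq _ (by rw [sub_add_cancel]; exact hr0), sub_add_cancel]
    linear_combination (r * (cos (2 * π * s) * (2 * π))) * e
  have hv : ∀ s : ℝ, HasDerivAt (fun s => -cos (2 * π * s) / (2 * π)) (sin (2 * π * s)) s := by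
    intro s
    refine ((hC s).fun_neg.div_const (2 * π)).congr_deriv ?_
    field_simp
  have hcu : Continuous fun s : ℝ => (r + 1) * |sin (2 * π * s)| ^ r * (cos (2 * π * s) * (2 * π)) :=
    (continuous_const.mul (continuous_abs_sin_rpow (by linarith))).mul (by fun_prop)
  have hibp := intervalIntegral.integral_mul_deriv_eq_deriv_mul (a := (0 : ℝ)) (b := 1)
    (fun s _ => hu s) (fun s _ => hv s) (hcu.intervalIntegrable 0 1)
    (continuous_sin_two_pi_mul.intervalIntegrable 0 1)
  have hS0 : sin (2 * π * 0) = 0 := by simp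
  have hS1 : sin (2 * π * 1) = 0 := by rw [mul_one, sin_two_pi]
  rw [hS0, hS1] at hibp
  simp only [mul_zero, zero_mul, sub_zero, zero_sub] at hibp
  -- `hibp : ∫ |S|^r S · S = -∫ (r+1)|S|^r (C·2π) · (−C/(2π))`
  have eL : ∫ s in (0 : ℝ)..1, |sin (2 * π * s)| ^ r * sin (2 * π * s) * sin (2 * π * s) =
      sinAbsMoment (r + 2) := by
    refine intervalIntegral.integral_congr fun s _ => ?_
    rw [mul_assoc, ← sq, abs_rpow_mul_sq _ (by linarith)]
  have eR : ∫ s in (0 : ℝ)..1, (r + 1) * |sin (2 * π * s)| ^ r * (cos (2 * π * s) * (2 * π)) *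
      (-cos (2 * π * s) / (2 * π)) = -((r + 1) * (sinAbsMoment r - sinAbsMoment (r + 2))) := by
    unfold sinAbsMoment
    rw [← intervalIntegral.integral_sub ((continuous_abs_sin_rpow (by linarith)).intervalIntegrable _ _)
      ((continuous_abs_sin_rpow (by linarith)).intervalIntegrable _ _), ← intervalIntegral.integral_const_mul,
      ← intervalIntegral.integral_neg]
    refine intervalIntegral.integral_congr fun s _ => ?_
    have hk : (r + 1) * |sin (2 * π * s)| ^ r * (cos (2 * π * s) * (2 * π)) * (-cos (2 * π * s) / (2 * π)) =
        -((r + 1) * |sin (2 * π * s)| ^ r * cos (2 * π * s) ^ 2) := by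
      rw [mul_div_assoc', div_eq_iff (by positivity)]; ring
    rw [← abs_rpow_mul_sq _ (by linarith), hk, cos_sq']
    ring
  rw [eL, eR] at hibp
  linarith

/-- **`3q·I(3q) = (3q − 1)·I(3q − 2)`** for real `q > 1`. [folklore; bookkeeping] -/
theorem sinAbsMoment_rec_three {q : ℝ} (hq : 1 < q) :
    3 * q * sinAbsMoment (3 * q) = (3 * q - 1) * sinAbsMoment (3 * q - 2) := by
  have h := sinAbsMoment_rec (r := 3 * q - 2) (by linarith)
  rw [show 3 * q - 2 + 2 = 3 * q by ring, show 3 * q - 2 + 1 = 3 * q - 1 by ring] at h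
  exact h

end TopEigLaminate

end Summit.NavierStokesRegularity.FunctionalMining

end
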